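import Literature.Computability.Complexity.IWAmplification
import Literature.Computability.Complexity.BlockOverwrite
import Mathlib.Algebra.Order.Floor.Ring
import Mathlib.Algebra.Order.Archimedean.Real.Basic
import HarnessLib

/-!
# Nisan–Wigderson information extraction (Hirahara 2022, Lemma 6.6) in counting form

Topic `Computability/Complexity`. Hirahara's "algorithmic information extraction lemma" for the
Nisan–Wigderson generator (ECCC TR22-119, Lemma 6.6, pp. 20–21): for a family `S = (S_p)` of
`ℓ`-blocks of `[d]`, functions `F_p : {0,1}^ℓ → {0,1}` and a test `D` on (seed, output bits) that reads
at most `m'` output positions, there is a set `B` of positions — those whose function is APPROXIMABLE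
from `D` with short advice — such that replacing the outputs `F_p(z|_{S_p})` at the positions OUTSIDE
`B` by fresh uniform bits changes the acceptance probability of `D` by at most `ε`. The printed lemma
measures "approximable with short advice" by an oracle Kolmogorov complexity `K^D_{1/2-ε/2m'}`; for the
NP-hardness of `MCSP*` only the COUNTING content is needed (how many functions are approximable), so
we prove the lemma with an explicit finite advice type instead (the reconstruction of Nisan–Wigderson
1994, Lemma 2.4 / Arora–Barak 2009, Lemma 20.15, with Yao's predictor): advice = the seed outside the
block, the uniform bits used at the other positions, a tie-break bit, and for every other position `q`
a table over the `|S_p ∩ S_q|` block bits it shares (`NWExtract.Adv`, `NWExtract.recon`).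

* `NWExtract.Approx η p h` — `h` agrees with some reconstruction `recon p a` on `≥ (1/2 + η) 2^ℓ` inputs;
* `NWExtract.card_real_sub_ideal_le` — **Lemma 6.6 (one test, one-sided, counting form)**: if `D`
  reads only the positions of `Rd` and no position of `Rd` outside the exempt set `X` is
  `η`-approximable, then `#{z | D accepts the real outputs} · 2^{|P|} - #{(z,u) | D accepts the outputs
  with uniform bits off X} ≤ η · |Rd| · 2ᵈ · 2^{|P|}`.

In Hirahara's application (proof of Lemma 8.3) the positions are `[n] × [Δ]`, `F_{(k,t)} = f̂_k`,
`X = {(k,t) | k ∈ B}` with `B = {k | some (k,t) is approximable}`, and `D = D_α` for each advice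
`α = (b, j, shares)`; the bound is applied with `η = ε₀ / m'`.

## References

* S. Hirahara, *NP-hardness of learning programs and partial MCSP*, ECCC TR22-119, Lemma 6.6 and its
  proof (pp. 20–21; hybrid argument, Yao's next-bit predictor, advice `∑_j 2^{|Sᵢ∩Sⱼ|} + a`)
  [Hirahara2022PartialMCSP].
* N. Nisan, A. Wigderson, *Hardness vs randomness*, JCSS 49 (1994), Lemma 2.4.
* S. Arora, B. Barak, *Computational Complexity: A Modern Approach*, CUP 2009, Lemma 20.15 and
  Thm. 20.10 (Yao) [AroraBarak2009].
-/

namespace Literature.Computability.Complexity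

open Finset

namespace NWExtract

variable {ℓ d : ℕ} {P : Type} [Fintype P] [DecidableEq P]

/-! ### Outputs, exempt positions, hybrids -/

section Setup

variable (E : P → (Fin ℓ ↪ Fin d)) (F : P → (Fin ℓ → Bool) → Bool) (X : P → Prop) [DecidablePred X]

/-- The real outputs `F_p(z|_{S_p})`. [cite: Hirahara2022PartialMCSP, Def. 6.3 (NW_S(f; z))] -/
def real (z : Fin d → Bool) : P → Bool := fun p => F p fun r => z (E p r)

/-- The outputs with the positions off the exempt set `X` replaced by the uniform bits `u`.
[cite: Hirahara2022PartialMCSP, Lemma 6.6 (X'ᵢ := Xᵢ if i ∈ B, uniform otherwise)] -/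
def idealX (z : Fin d → Bool) (u : P → Bool) : P → Bool :=
  fun p => if X p then F p fun r => z (E p r) else u p

/-- The `i`-th hybrid along an enumeration `rank` of the positions: exempt positions and positions of
rank `< i` are real, the others uniform. [cite: Hirahara2022PartialMCSP, proof of Lemma 6.6 (hybrids Hᵢ)] -/
def hyb (rank : P ≃ Fin (Fintype.card P)) (i : ℕ) (z : Fin d → Bool) (u : P → Bool) : P → Bool :=
  fun p => if X p ∨ (rank p : ℕ) < i then F p fun r => z (E p r) else u p

/-- Acceptance count of `D` on the `i`-th hybrid. [cite: Hirahara2022PartialMCSP, proof of Lemma 6.6] -/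
def cnt (rank : P ≃ Fin (Fintype.card P)) (D : (Fin d → Bool) → (P → Bool) → Bool) (i : ℕ) : ℤ :=
  ∑ z : Fin d → Bool, ∑ u : P → Bool, IWAmp.b2i (D z (hyb E F X rank i z u))

variable {E F X}

omit [DecidableEq P] in
/-- `Hyb₀` is the ideal end. [cite: Hirahara2022PartialMCSP, proof of Lemma 6.6 (H₀)] -/
theorem hyb_zero (rank : P ≃ Fin (Fintype.card P)) (z : Fin d → Bool) (u : P → Bool) :
    hyb E F X rank 0 z u = idealX E F X z u := by
  funext p; simp [hyb, idealX]

omit [DecidableEq P] in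
/-- `Hyb_{|P|}` is the real end. [cite: Hirahara2022PartialMCSP, proof of Lemma 6.6 (H_m)] -/
theorem hyb_top (rank : P ≃ Fin (Fintype.card P)) (z : Fin d → Bool) (u : P → Bool) :
    hyb E F X rank (Fintype.card P) z u = real E F z := by
  funext p; simp [hyb, real, (rank p).isLt]

/-- A step at an exempt position, or at a position the test does not read, contributes nothing.
[cite: Hirahara2022PartialMCSP, proof of Lemma 6.6 ("H_{i-1} is identical to Hᵢ if i ∉ I … if i ∈ B")] -/
theorem cnt_succ_eq (rank : P ≃ Fin (Fintype.card P)) {D : (Fin d → Bool) → (P → Bool) → Bool}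
    {Rd : Finset P} (hloc : ∀ z Y Y', (∀ p ∈ Rd, Y p = Y' p) → D z Y = D z Y') (i : Fin (Fintype.card P))
    (hi : X (rank.symm i) ∨ rank.symm i ∉ Rd) :
    cnt E F X rank D (i + 1) = cnt E F X rank D i := by
  unfold cnt
  refine Finset.sum_congr rfl fun z _ => Finset.sum_congr rfl fun u _ => ?_
  congr 1
  apply hloc
  intro p hp
  unfold hyb
  by_cases hpi : p = rank.symm i
  · subst hpi
    rcases hi with hx | hn
    · simp [hx]
    · exact absurd hp hn
  · have hne : (rank p : ℕ) ≠ i := fun h => hpi (by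
      rw [Equiv.eq_symm_apply]; exact Fin.ext h)
    have : ((rank p : ℕ) < i + 1) ↔ ((rank p : ℕ) < i) := by omega
    simp only [this]

/-- **Pigeonhole**: if the total gap exceeds `t ≥ 0`, some NON-exempt READ position carries a step
gap `G` with `|Rd| · G > t`. [cite: Hirahara2022PartialMCSP, proof of Lemma 6.6 ("there exists an index i ∈ I such that … ≥ ε/m'")] -/
theorem exists_step (rank : P ≃ Fin (Fintype.card P)) {D : (Fin d → Bool) → (P → Bool) → Bool}
    {Rd : Finset P} (hloc : ∀ z Y Y', (∀ p ∈ Rd, Y p = Y' p) → D z Y = D z Y') {t : ℤ} (ht : 0 ≤ t)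
    (hgap : t < cnt E F X rank D (Fintype.card P) - cnt E F X rank D 0) :
    ∃ i : Fin (Fintype.card P), ¬X (rank.symm i) ∧ rank.symm i ∈ Rd ∧
      t < Rd.card * (cnt E F X rank D (i + 1) - cnt E F X rank D i) := by
  classical
  set S := (univ : Finset (Fin (Fintype.card P))).filter fun i => ¬X (rank.symm i) ∧ rank.symm i ∈ Rd
    with hS
  have htel : ∑ i ∈ range (Fintype.card P), (cnt E F X rank D (i + 1) - cnt E F X rank D i) =
      cnt E F X rank D (Fintype.card P) - cnt E F X rank D 0 := Finset.sum_range_sub _ _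
  -- only the steps in `S` count
  have hsumS : ∑ i ∈ S, (cnt E F X rank D (i + 1) - cnt E F X rank D i) =
      cnt E F X rank D (Fintype.card P) - cnt E F X rank D 0 := by
    rw [← htel, ← Fin.sum_univ_eq_sum_range]
    rw [hS, Finset.sum_filter]
    refine Finset.sum_congr rfl fun i _ => ?_
    split_ifs with h
    · rfl
    · rw [cnt_succ_eq rank hloc i (by tauto), sub_self]
  have hSne : S.Nonempty := by
    by_contra hcon
    rw [Finset.not_nonempty_iff_eq_empty] at hcon
    rw [hcon, Finset.sum_empty] at hsumS
    linarith
  -- some `i ∈ S` has `|S| Gᵢ ≥ total`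
  have hconst : ∑ _i ∈ S, (cnt E F X rank D (Fintype.card P) - cnt E F X rank D 0) ≤
      ∑ i ∈ S, (S.card : ℤ) * (cnt E F X rank D (i + 1) - cnt E F X rank D i) := by
    rw [sum_const, ← Finset.mul_sum, hsumS, nsmul_eq_mul]
  obtain ⟨i, hiS, hi⟩ := Finset.exists_le_of_sum_le hSne hconst
  have hiS' := (mem_filter.1 hiS).2
  refine ⟨i, hiS'.1, hiS'.2, ?_⟩
  have hG : 0 < cnt E F X rank D (i + 1) - cnt E F X rank D i := by
    by_contra hle
    rw [not_lt] at hle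
    have : (S.card : ℤ) * (cnt E F X rank D (i + 1) - cnt E F X rank D i) ≤ 0 :=
      mul_nonpos_of_nonneg_of_nonpos (Nat.cast_nonneg _) hle
    linarith
  have hScard : (S.card : ℤ) ≤ Rd.card := by
    have : S.card ≤ Rd.card := by
      calc S.card ≤ (Rd.image rank).card := card_le_card fun i hi => by
              have h := (mem_filter.1 hi).2.2
              exact mem_image.2 ⟨rank.symm i, h, by simp⟩
        _ ≤ Rd.card := card_image_le
    exact_mod_cast this
  calc t < cnt E F X rank D (Fintype.card P) - cnt E F X rank D 0 := hgap
    _ ≤ S.card * (cnt E F X rank D (i + 1) - cnt E F X rank D i) := hi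
    _ ≤ Rd.card * (cnt E F X rank D (i + 1) - cnt E F X rank D i) :=
        mul_le_mul_of_nonneg_right hScard hG.le

end Setup

/-! ### Advice and reconstruction -/

section Advice

variable (E : P → (Fin ℓ ↪ Fin d))

/-- The positions of block `p` read by block `q ≠ p`. [cite: Hirahara2022PartialMCSP, proof of Lemma 6.6 (advice indexed by (j, z_{Sᵢ ∩ Sⱼ}))] -/
abbrev Tsub (p q : P) : Type := {r' : Fin ℓ // q ≠ p ∧ ∃ r : Fin ℓ, E q r = E p r'}

/-- **Advice for reconstructing the function at position `p`**: the seed outside the block, the bits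
used at the other positions, a tie-break bit, and a table per position over the shared block bits
(`|advice| ≤ d + |P| + 1 + ∑_q 2^{|S_p ∩ S_q|}` bits — the `∑_j 2^{|Sᵢ∩Sⱼ|} + a` of Lemma 6.6).
[cite: Hirahara2022PartialMCSP, Lemma 6.6 (K^D bound ∑_{j≠i} 2^{|Sᵢ∩Sⱼ|} + a + O(log …))] -/
abbrev Adv (p : P) : Type := (Fin d → Bool) × (P → Bool) × Bool × ((q : P) → (Tsub E p q → Bool) → Bool)

variable {E}

/-- The seed with the challenge `y` on block `p`. [cite: Hirahara2022PartialMCSP, proof of Lemma 6.6] -/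
noncomputable def advSeed (p : P) (zo : Fin d → Bool) (y : Fin ℓ → Bool) : Fin d → Bool :=
  Function.extend (E p) y zo

/-- The one-query test of the advice. [cite: Hirahara2022PartialMCSP, proof of Lemma 6.6 (the D-oracle circuit P^D)] -/
noncomputable def advTest (D : (Fin d → Bool) → (P → Bool) → Bool) (p : P) (a : Adv E p) (y : Fin ℓ → Bool) (b : Bool) : Bool :=
  D (advSeed (E := E) p a.1 y) fun q => if q = p then b else a.2.2.2 q fun r' => y r'.1

/-- **The reconstruction** `recon D p a : {0,1}^ℓ → {0,1}` (Yao's predictor of the one-query test).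
[cite: Hirahara2022PartialMCSP, proof of Lemma 6.6 ("By using Yao's next-bit predictor … P^D")] -/
noncomputable def recon (D : (Fin d → Bool) → (P → Bool) → Bool) (p : P) (a : Adv E p) (y : Fin ℓ → Bool) : Bool :=
  IWAmp.pred (advTest D p a) a.2.2.1 y

/-- `h` is `η`-**approximable at position `p`** from `D`: some reconstruction agrees with `h` on at
least `(1/2 + η) 2^ℓ` inputs. [cite: Hirahara2022PartialMCSP, Lemma 6.6 (B := {i | K^D_δ(fᵢ) ≤ θᵢ}, δ = 1/2 - ε/2m')] -/
def Approx (D : (Fin d → Bool) → (P → Bool) → Bool) (η : ℝ) (p : P) (h : (Fin ℓ → Bool) → Bool) : Prop :=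
  ∃ a : Adv E p, (1 / 2 + η) * Fintype.card (Fin ℓ → Bool) ≤
    ((univ.filter fun y : Fin ℓ → Bool => recon (E := E) D p a y = h y).card : ℝ)

/-- The canonical extension of a key on `Tsub E p q`. [folklore] -/
noncomputable def extKey (p q : P) (key : Tsub E p q → Bool) : Fin ℓ → Bool :=
  fun r' => if h : q ≠ p ∧ ∃ r : Fin ℓ, E q r = E p r' then key ⟨r', h⟩ else false

omit [Fintype P] in
/-- Block `q ≠ p` only reads the shared bits of the challenge. [cite: Hirahara2022PartialMCSP, proof of Lemma 6.6 ("we write down fⱼ(z_{Sⱼ}) as one bit … indexed by (j, z_{Sᵢ∩Sⱼ})")] -/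
theorem advSeed_comp_ext {p q : P} (hqp : q ≠ p) (zo : Fin d → Bool) (y : Fin ℓ → Bool) :
    (fun r => advSeed (E := E) p zo y (E q r)) =
      fun r => advSeed (E := E) p zo (extKey (E := E) p q fun r' => y r'.1) (E q r) := by
  funext r
  simp only [advSeed, Function.extend_def]
  by_cases h : ∃ r', E p r' = E q r
  · rw [dif_pos h, dif_pos h]
    have hmem : q ≠ p ∧ ∃ r₀ : Fin ℓ, E q r₀ = E p (Classical.choose h) :=
      ⟨hqp, r, (Classical.choose_spec h).symm⟩
    simp only [extKey, dif_pos hmem]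
  · rw [dif_neg h, dif_neg h]

omit [Fintype P] in
/-- Under the design property, block `q ≠ p` reads at most `ρ` positions of block `p`.
[cite: Hirahara2022PartialMCSP, Prop. 6.2 and Lemma 6.6 (|Sᵢ ∩ Sⱼ| ≤ ρ)] -/
theorem card_Tsub_le {ρ : ℕ} (hdes : ∀ ⦃p q : P⦄, p ≠ q → (univ.map (E p) ∩ univ.map (E q)).card ≤ ρ)
    (p q : P) : Fintype.card (Tsub E p q) ≤ ρ := by
  classical
  by_cases hqp : q = p
  · have : IsEmpty (Tsub E p q) := ⟨fun r' => r'.2.1 hqp⟩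
    rw [Fintype.card_eq_zero]; exact Nat.zero_le _
  · have hinj : Function.Injective fun r' : Tsub E p q =>
        (⟨E p r'.1, by
          rw [mem_inter, mem_map, mem_map]
          obtain ⟨r, hr⟩ := r'.2.2
          exact ⟨⟨r'.1, mem_univ _, rfl⟩, ⟨r, mem_univ _, hr⟩⟩⟩ :
          ((univ.map (E p) ∩ univ.map (E q) : Finset (Fin d)))) := by
      intro a b hab
      have := congrArg (fun x : ((univ.map (E p) ∩ univ.map (E q) : Finset (Fin d))) => (x : Fin d)) hab
      exact Subtype.ext ((E p).injective this)
    have h := Fintype.card_le_of_injective _ hinj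
    rw [Fintype.card_coe] at h
    exact h.trans (hdes (Ne.symm hqp))

/-- **Size of the advice of Lemma 6.6**: `|Adv p| ≤ 2ᵈ · 2^{|P|} · 2 · 2^{|P|·2^ρ}` (the printed
`∑_{j≠i} 2^{|Sᵢ∩Sⱼ|} + a + …` bits). [cite: Hirahara2022PartialMCSP, Lemma 6.6 (the bound on K^D)] -/
theorem card_Adv_le {ρ : ℕ} (hdes : ∀ ⦃p q : P⦄, p ≠ q → (univ.map (E p) ∩ univ.map (E q)).card ≤ ρ)
    (p : P) : Fintype.card (Adv E p) ≤ 2 ^ d * 2 ^ Fintype.card P * 2 * 2 ^ (Fintype.card P * 2 ^ ρ) := by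
  classical
  have h1 := Fintype.card_prod (Fin d → Bool) ((P → Bool) × Bool × ((q : P) → (Tsub E p q → Bool) → Bool))
  have h2 := Fintype.card_prod (P → Bool) (Bool × ((q : P) → (Tsub E p q → Bool) → Bool))
  have h3 := Fintype.card_prod Bool ((q : P) → (Tsub E p q → Bool) → Bool)
  have hd : Fintype.card (Fin d → Bool) = 2 ^ d := by simp
  have hP : Fintype.card (P → Bool) = 2 ^ Fintype.card P := by simp
  rw [h1, h2, h3, hd, hP, Fintype.card_bool, Fintype.card_pi]
  have htab : ∏ q : P, Fintype.card ((Tsub E p q → Bool) → Bool) ≤ 2 ^ (Fintype.card P * 2 ^ ρ) := by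
    calc ∏ q : P, Fintype.card ((Tsub E p q → Bool) → Bool)
        ≤ ∏ _q : P, 2 ^ (2 ^ ρ) := Finset.prod_le_prod' fun q _ => by
            rw [Fintype.card_fun, Fintype.card_fun, Fintype.card_bool]
            exact Nat.pow_le_pow_right (by norm_num)
              (Nat.pow_le_pow_right (by norm_num) (card_Tsub_le hdes p q))
      _ = 2 ^ (Fintype.card P * 2 ^ ρ) := by rw [prod_const, card_univ, ← pow_mul, mul_comm]
  calc 2 ^ d * (2 ^ Fintype.card P * (2 * ∏ q : P, Fintype.card ((Tsub E p q → Bool) → Bool)))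
      ≤ 2 ^ d * (2 ^ Fintype.card P * (2 * 2 ^ (Fintype.card P * 2 ^ ρ))) := by gcongr
    _ = 2 ^ d * 2 ^ Fintype.card P * 2 * 2 ^ (Fintype.card P * 2 ^ ρ) := by ring

end Advice

/-! ### Lemma 6.6 -/

section Main

variable {E : P → (Fin ℓ ↪ Fin d)} {F : P → (Fin ℓ → Bool) → Bool} {X : P → Prop} [DecidablePred X]

/-- `σ_P = 2[P = h] - 1` summed: `∑ sgn = 2 #{agree} - 2^ℓ`. [folklore] -/
theorem sum_sgn_eq (h Q : (Fin ℓ → Bool) → Bool) :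
    ∑ y, HardCore.sgn h Q y = 2 * ((univ.filter fun y : Fin ℓ → Bool => Q y = h y).card : ℤ) -
      Fintype.card (Fin ℓ → Bool) := by
  have hs : ∀ y, HardCore.sgn h Q y = 2 * (if Q y = h y then 1 else 0) - 1 := fun y => by
    unfold HardCore.sgn; split_ifs <;> norm_num
  simp_rw [hs, Finset.sum_sub_distrib, ← Finset.mul_sum, Finset.sum_boole, sum_const, card_univ]
  simp

/-- **Hirahara 2022, Lemma 6.6 — NW information extraction, counting form (one test, one-sided).**
Let `D` read only the output positions in `Rd`, let `X` be a set of exempt positions such that no read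
position outside `X` has an `η`-approximable function (`η ≥ 0`). Then
`#{z | D(z, real outputs)} · 2^{|P|} - #{(z, u) | D(z, outputs with uniform bits off X)} ≤ η |Rd| 2ᵈ 2^{|P|}`:
otherwise a hybrid step at some non-exempt read position `p` has gap `> η 2ᵈ 2^{|P|}`, and fixing the
seed off `S_p` and the other uniform bits, Yao's predictor with the true tables agrees with `F_p` on
`> (1/2 + η) 2^ℓ` inputs — i.e. `F_p` is `η`-approximable.
[cite: Hirahara2022PartialMCSP, Lemma 6.6 and its proof (pp. 20–21)] -/
theorem card_real_sub_ideal_le {D : (Fin d → Bool) → (P → Bool) → Bool} {Rd : Finset P}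
    (hloc : ∀ z Y Y', (∀ p ∈ Rd, Y p = Y' p) → D z Y = D z Y') {η : ℝ} (hη : 0 ≤ η)
    (hX : ∀ p ∈ Rd, ¬X p → ¬Approx (E := E) D η p (F p)) :
    ((univ.filter fun z : Fin d → Bool => D z (real E F z)).card : ℝ) * Fintype.card (P → Bool) -
        ((univ.filter fun zu : (Fin d → Bool) × (P → Bool) => D zu.1 (idealX E F X zu.1 zu.2)).card : ℝ) ≤
      η * Rd.card * Fintype.card (Fin d → Bool) * Fintype.card (P → Bool) := by
  classical
  set rank := Fintype.equivFin P with hrank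
  -- the two ends of the hybrid as `cnt`
  have htop : cnt E F X rank D (Fintype.card P) =
      ((univ.filter fun z : Fin d → Bool => D z (real E F z)).card : ℤ) * Fintype.card (P → Bool) := by
    unfold cnt
    simp_rw [hyb_top, sum_const, card_univ, nsmul_eq_mul]
    rw [← Finset.mul_sum]
    unfold IWAmp.b2i
    rw [Finset.sum_boole, mul_comm]
  have hbot : cnt E F X rank D 0 =
      ((univ.filter fun zu : (Fin d → Bool) × (P → Bool) => D zu.1 (idealX E F X zu.1 zu.2)).card : ℤ) := by
    unfold cnt
    simp_rw [hyb_zero]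
    rw [← Fintype.sum_prod_type' (f := fun z u => IWAmp.b2i (D z (idealX E F X z u)))]
    unfold IWAmp.b2i
    rw [Finset.sum_boole]
  -- suppose the gap is large
  by_contra hcon
  rw [not_le] at hcon
  set t : ℤ := ⌊η * Rd.card * Fintype.card (Fin d → Bool) * Fintype.card (P → Bool)⌋ with ht
  have ht0 : 0 ≤ t := by rw [ht]; positivity
  have hgap : t < cnt E F X rank D (Fintype.card P) - cnt E F X rank D 0 := by
    rw [htop, hbot]
    have h1 : (t : ℝ) ≤ η * Rd.card * Fintype.card (Fin d → Bool) * Fintype.card (P → Bool) := Int.floor_le _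
    have h2 : (t : ℝ) < ((univ.filter fun z : Fin d → Bool => D z (real E F z)).card : ℝ) *
        Fintype.card (P → Bool) -
        ((univ.filter fun zu : (Fin d → Bool) × (P → Bool) => D zu.1 (idealX E F X zu.1 zu.2)).card : ℝ) :=
      h1.trans_lt hcon
    exact_mod_cast h2
  obtain ⟨i, hXi, hRi, hstep⟩ := exists_step rank hloc ht0 hgap
  set p := rank.symm i with hp
  have hrp : (rank p : ℕ) = i := by rw [hp]; simp
  -- the step gap at `p`
  set G := cnt E F X rank D (i + 1) - cnt E F X rank D i with hG
  set g : (Fin d → Bool) → (P → Bool) → ℤ := fun z u =>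
    IWAmp.b2i (D z (hyb E F X rank (i + 1) z u)) - IWAmp.b2i (D z (hyb E F X rank i z u)) with hg
  have hGg : G = ∑ z, ∑ u, g z u := by
    simp only [hG, cnt, hg, Finset.sum_sub_distrib]
  -- bits with position `p` set to `bi`
  set bitsAt : (Fin d → Bool) → (P → Bool) → Bool → P → Bool := fun z uo bi q =>
    if q = p then bi else if X q ∨ (rank q : ℕ) < i then F q (fun r => z (E q r)) else uo q with hbits
  have hsucc : ∀ z uo o, hyb E F X rank (i + 1) z (Function.update uo p o) =
      bitsAt z uo (F p fun r => z (E p r)) := by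
    intro z uo o; funext q
    simp only [hyb, hbits]
    by_cases hq : q = p
    · subst hq; simp [hrp]
    · have hne : (rank q : ℕ) ≠ i := fun h => hq (by
        rw [hp, Equiv.eq_symm_apply]; exact Fin.ext h)
      have hiff : (X q ∨ (rank q : ℕ) < i + 1) ↔ (X q ∨ (rank q : ℕ) < i) := by
        constructor <;> rintro (h | h) <;> first | exact Or.inl h | (right; omega)
      rw [if_neg hq, Function.update_of_ne hq]
      exact if_congr hiff rfl rfl
  have hcur : ∀ z uo o, hyb E F X rank i z (Function.update uo p o) = bitsAt z uo o := by
    intro z uo o; funext q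
    simp only [hyb, hbits]
    by_cases hq : q = p
    · subst hq
      simp [hrp, hXi]
    · rw [if_neg hq, Function.update_of_ne hq]
  -- re-index: block `p` of the seed, position `p` of the uniform bits
  set inner : (Fin d → Bool) × (P → Bool) → ℤ := fun t =>
    ∑ y : Fin ℓ → Bool, ∑ o : Bool, g (Function.extend (E p) y t.1) (Function.update t.2 p o)
    with hinner
  have hsum : (Fintype.card Bool : ℤ) * Fintype.card (Fin ℓ → Bool) * G = ∑ t, inner t := by
    rw [hGg]
    have h1 := BlockOverwrite.sum_sum_extend (E p) (fun z => ∑ u : P → Bool, g z u)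
    have h2 : ∀ (zo : Fin d → Bool) (y : Fin ℓ → Bool),
        ∑ uo : P → Bool, ∑ o : Bool, g (Function.extend (E p) y zo) (Function.update uo p o) =
          Fintype.card Bool * ∑ u, g (Function.extend (E p) y zo) u :=
      fun zo y => BlockOverwrite.sum_sum_update p _
    calc (Fintype.card Bool : ℤ) * Fintype.card (Fin ℓ → Bool) * ∑ z, ∑ u, g z u
        = Fintype.card Bool * ∑ zo : Fin d → Bool, ∑ y : Fin ℓ → Bool,
            ∑ u, g (Function.extend (E p) y zo) u := by rw [h1]; ring
      _ = ∑ zo : Fin d → Bool, ∑ y : Fin ℓ → Bool, ∑ uo : P → Bool, ∑ o : Bool,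
            g (Function.extend (E p) y zo) (Function.update uo p o) := by
          simp only [Finset.mul_sum, h2]
      _ = ∑ t, inner t := by
          simp only [hinner, Fintype.sum_prod_type]
          refine Finset.sum_congr rfl fun zo _ => ?_
          rw [Finset.sum_comm]
  haveI : Nonempty ((Fin d → Bool) × (P → Bool)) := inferInstance
  obtain ⟨⟨zo, uo⟩, hrest⟩ := BlockOverwrite.exists_sum_le_card_nsmul inner
  rw [nsmul_eq_mul] at hrest
  -- the inner sum as a one-query gap (with `M ≡ 1`, `C = 1`, no real randomness: `|Ω| = 2`)
  set A : (Fin ℓ → Bool) → Bool → Bool := fun y bi =>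
    D (Function.extend (E p) y zo) (bitsAt (Function.extend (E p) y zo) uo bi) with hA
  have hyblk : ∀ y : Fin ℓ → Bool,
      (fun r => Function.extend (E p) y zo (E p r)) = y := fun y =>
    funext fun r => (E p).injective.extend_apply y zo r
  have hgy : ∀ (y : Fin ℓ → Bool) (o : Bool),
      g (Function.extend (E p) y zo) (Function.update uo p o) =
        IWAmp.b2i (A y (F p y)) - IWAmp.b2i (A y o) := by
    intro y o
    simp only [hg, hsucc, hcur, hyblk]
    rfl
  have hinnerA : inner (zo, uo) =
      ∑ y, (1 : ℤ) * (IWAmp.b2i (A y (F p y)) - IWAmp.b2i (A y (!F p y))) := by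
    simp only [hinner]
    refine Finset.sum_congr rfl fun y _ => ?_
    rw [Fintype.sum_bool, hgy, hgy, one_mul]
    rcases Bool.eq_false_or_eq_true (F p y) with h | h <;> rw [h] <;> simp
  obtain ⟨c, hc⟩ := IWAmp.exists_pred_adv_ge (fun _ => (1 : ℕ)) A (F p)
  push_cast at hc
  rw [← hinnerA] at hc
  simp only [one_mul] at hc
  -- `A` is the advice test with the true tables
  set tab : (q : P) → (Tsub E p q → Bool) → Bool := fun q key =>
    if X q ∨ (rank q : ℕ) < i then
      F q (fun r => advSeed (E := E) p zo (extKey (E := E) p q key) (E q r)) else uo q with htab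
  set a : Adv E p := (zo, uo, c, tab) with ha
  have hAa : ∀ y bi, A y bi = advTest (E := E) D p a y bi := by
    intro y bi
    change D (Function.extend (E p) y zo)
        (bitsAt (Function.extend (E p) y zo) uo bi) =
      D (advSeed (E := E) p zo y) (fun q => if q = p then bi else tab q fun r' => y r'.1)
    congr 1
    funext q
    simp only [hbits]
    by_cases hq : q = p
    · subst hq; simp
    · rw [if_neg hq, if_neg hq, htab]
      simp only
      split_ifs with hx
      · congr 1
        exact advSeed_comp_ext (E := E) hq zo y
      · rfl
  have hAfun : A = advTest (E := E) D p a := funext fun y => funext fun bi => hAa y bi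
  have hrecon : IWAmp.pred A c = recon (E := E) D p a := by
    funext y; rw [hAfun]; rfl
  -- `F_p` is approximable: contradiction
  refine hX p hRi hXi ⟨a, ?_⟩
  rw [← hrecon]
  have hsgn := sum_sgn_eq (F p) (IWAmp.pred A c)
  -- chain: `2 · 2^ℓ · G ≤ |Rest| inner ≤ |Rest| ∑ sgn = |Rest| (2 #agree - 2^ℓ)` and `|Rd| G > t`
  have hRestcard : (Fintype.card ((Fin d → Bool) × (P → Bool)) : ℤ) =
      Fintype.card (Fin d → Bool) * Fintype.card (P → Bool) := by exact_mod_cast Fintype.card_prod _ _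
  have h1 : (2 : ℤ) * Fintype.card (Fin ℓ → Bool) * G ≤
      Fintype.card (Fin d → Bool) * Fintype.card (P → Bool) * ∑ y, HardCore.sgn (F p) (IWAmp.pred A c) y := by
    have hB : (Fintype.card Bool : ℤ) = 2 := by simp
    rw [← hB, hsum, ← hRestcard]
    exact hrest.trans (mul_le_mul_of_nonneg_left hc (Nat.cast_nonneg _))
  rw [hsgn] at h1
  -- move to ℝ
  have hRd0 : (0 : ℝ) < Rd.card := by
    have : 0 < Rd.card := Finset.card_pos.2 ⟨p, hRi⟩
    exact_mod_cast this
  have hV : (0 : ℝ) < Fintype.card (Fin ℓ → Bool) := by exact_mod_cast Fintype.card_pos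
  have hZ : (0 : ℝ) < Fintype.card (Fin d → Bool) := by exact_mod_cast Fintype.card_pos
  have hU : (0 : ℝ) < Fintype.card (P → Bool) := by exact_mod_cast Fintype.card_pos
  have h1R : (2 : ℝ) * Fintype.card (Fin ℓ → Bool) * G ≤
      Fintype.card (Fin d → Bool) * Fintype.card (P → Bool) *
        (2 * ((univ.filter fun y : Fin ℓ → Bool => IWAmp.pred A c y = F p y).card : ℝ) -
          Fintype.card (Fin ℓ → Bool)) := by exact_mod_cast h1
  have hstepR : (t : ℝ) < Rd.card * (G : ℝ) := by exact_mod_cast hstep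
  have htR : η * Rd.card * Fintype.card (Fin d → Bool) * Fintype.card (P → Bool) < t + 1 := by
    rw [ht]; exact Int.lt_floor_add_one _
  -- hence `G > (η 2ᵈ 2^{|P|} - 1/|Rd|)`… we use the integrality: `|Rd| G ≥ t + 1 > η |Rd| 2ᵈ 2^{|P|}`
  have hstepI : t + 1 ≤ Rd.card * G := hstep
  have hstepR' : η * Rd.card * Fintype.card (Fin d → Bool) * Fintype.card (P → Bool) < Rd.card * (G : ℝ) := by
    have : ((t + 1 : ℤ) : ℝ) ≤ Rd.card * (G : ℝ) := by exact_mod_cast hstepI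
    push_cast at this; linarith
  -- `G > η 2ᵈ 2^{|P|}`
  have hGR : η * Fintype.card (Fin d → Bool) * Fintype.card (P → Bool) < (G : ℝ) := by
    have h := hstepR'
    rw [show η * Rd.card * Fintype.card (Fin d → Bool) * Fintype.card (P → Bool) =
      Rd.card * (η * Fintype.card (Fin d → Bool) * Fintype.card (P → Bool)) by ring] at h
    exact lt_of_mul_lt_mul_left h hRd0.le
  -- combine with `h1R`
  nlinarith [mul_pos hZ hU]

end Main

end NWExtract

end Literature.Computability.Complexity
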